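import Summits.KontsevichZagierPeriods.KontsevichZagierPeriods.Theorems.GpcZeta4Eq4zeta31.Negative.Core
import Summits.KontsevichZagierPeriods.KontsevichZagierPeriods.Theorems.HoffmanRelationInKZ.Negative.WindowWeightFour

/-!
# `GpcZeta4Eq4zeta31` (stmt-KontsevichZagierPeriods-0275): negative side — load-bearing hypotheses

Companion of `Negative/Core.lean` (cdisprove unit of the crux `GpcZeta4Eq4zeta31`, route
`Grothendieck`). **Each of the four hypotheses of the crux, and the constant `4`, is necessary**: with
any one of them dropped the statement is FALSE by soundness of the calculus
(`KZ.Equivalent.value_eq_holds`). Witnesses live on the box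
`B = (1/2,3/5) × (1/5,1/4) × (3/20,1/5) × (1/20,1/10) ⊆ Δ₄` of
`HoffmanRelationInKZ/Negative/WindowWeightFour.lean` (shown `ℚ`-semialgebraic here, so that it is a
legitimate domain), where `t₂ < 1/5` makes `ω₀ω₀ω₀ω₁ − 4·ω₀ω₀ω₁ω₁ > 0` pointwise:

* `crux_false_without_domain` — drop `r.domain = Δ₄`: `[B, ω₀₀₀₁]` and `[B, 4ω₀₀₁₁]` have different values;
* `crux_false_without_integrand` — drop the hypothesis on `r.integrand`: `r = [Δ₄, 0]`;
* `crux_false_without_domain'` — drop `r'.domain = r.domain`: `r' = [∅, 0]`;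
* `crux_false_without_integrand'` — drop the hypothesis on `r'.integrand`: `r' = [Δ₄, 0]`;
* `coeff_eq_four_of_mem`, `eval_withCoeff_eq_zero_iff`, `crux_false_withCoeff` — the constant: for a
  rational `q`, `[Δ₄, ω₀₀₀₁] − [Δ₄, q·ω₀₀₁₁] ∈ relations` forces `q = 4`; in particular the naive
  readings "`ζ(4) = ζ(3,1)`" and "`ζ(4) = 2ζ(3,1)`" are false in the calculus.

Sources: M. Kontsevich, D. Zagier, *Periods* (2001), §1.2 (soundness of the rules).
-/

noncomputable section

namespace Summit.KontsevichZagierPeriods.GpcZeta4Eq4zeta31.Negative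

open Set MeasureTheory
open Literature.NumberTheory.Transcendental
open Literature.NumberTheory.Transcendental.KZ
open Summit.KontsevichZagierPeriods.KontsevichZagierPeriods.Theses.Grothendieck (GpcZeta4Eq4zeta31)
open Summit.KontsevichZagierPeriods.MzvKernelInKZ.Negative
open Summit.KontsevichZagierPeriods.HoffmanRelationInKZ.Negative
  (window isOpen_window measurableSet_window setIntegral_pos_of_pos_on lo₄ hi₄ mem_window₄ window₄_subset
    window₄_nonempty)

/-! ## §3 Load-bearing hypotheses: each of the four hypotheses, and the constant `4`, is necessary

The witnesses live on the box `B = (1/2,3/5) × (1/5,1/4) × (3/20,1/5) × (1/20,1/10) ⊆ Δ₄` of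
`HoffmanRelationInKZ/Negative/WindowWeightFour.lean`, where `t₂ < 1/5` makes
`ω₀ω₀ω₀ω₁ − 4·ω₀ω₀ω₁ω₁ = (t₀t₁(1−t₃))⁻¹ (t₂⁻¹ − 4(1−t₂)⁻¹) > 0` pointwise. -/

/-- The first integrand as a product of inverses. [folklore] -/
theorem wordFun_ω4_one_inv (t : Fin 4 → ℝ) :
    wordFun ω4 1 t = (t 0)⁻¹ * (t 1)⁻¹ * (t 2)⁻¹ * (1 - t 3)⁻¹ := by
  rw [wordFun_ω4_one]; simp only [one_div, mul_inv]

/-- The second integrand (coefficient `q`) as a product of inverses. [folklore] -/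
theorem wordFun_ω31_inv (q : ℚ) (t : Fin 4 → ℝ) :
    wordFun ω31 q t = (q : ℝ) * ((t 0)⁻¹ * (t 1)⁻¹ * (1 - t 2)⁻¹ * (1 - t 3)⁻¹) := by
  rw [wordFun_ω31]; simp only [div_eq_mul_inv, mul_inv]

/-- **Pointwise gap on the box**: `ω₀₀₀₁ − 4ω₀₀₁₁ > 0` where `t₂ < 1/5`. [folklore] -/
theorem gap_pos {t : Fin 4 → ℝ} (ht : t ∈ window lo₄ hi₄ 4) : 0 < wordFun ω4 1 t - wordFun ω31 4 t := by
  obtain ⟨h0, -, h1, -, h2, h2', -, h3'⟩ := mem_window₄ ht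
  rw [wordFun_ω4_one_inv, wordFun_ω31_inv]
  have A : 0 < (t 0)⁻¹ := inv_pos.mpr (by linarith)
  have B : 0 < (t 1)⁻¹ := inv_pos.mpr (by linarith)
  have C : 0 < (1 - t 3)⁻¹ := inv_pos.mpr (by linarith)
  have hpos2 : 0 < t 2 := by linarith
  have hpos2' : 0 < 1 - t 2 := by linarith
  have key : 4 * (1 - t 2)⁻¹ < (t 2)⁻¹ := by
    rw [← div_eq_mul_inv, ← one_div, div_lt_div_iff₀ hpos2' hpos2]
    linarith
  have e : (t 0)⁻¹ * (t 1)⁻¹ * (t 2)⁻¹ * (1 - t 3)⁻¹ -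
      ((4 : ℚ) : ℝ) * ((t 0)⁻¹ * (t 1)⁻¹ * (1 - t 2)⁻¹ * (1 - t 3)⁻¹) =
      (t 0)⁻¹ * (t 1)⁻¹ * (1 - t 3)⁻¹ * ((t 2)⁻¹ - 4 * (1 - t 2)⁻¹) := by
    push_cast; ring
  rw [e]
  exact mul_pos (mul_pos (mul_pos A B) C) (sub_pos.2 key)

/-- **The integrated gap on the box is positive**: `∫_B ω₀₀₀₁ − ∫_B 4ω₀₀₁₁ > 0`. [folklore] -/
theorem integral_gap_pos :
    0 < (∫ x in window lo₄ hi₄ 4, wordFun ω4 1 x) - ∫ x in window lo₄ hi₄ 4, wordFun ω31 4 x := by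
  have i4 : IntegrableOn (wordFun ω4 1) (window lo₄ hi₄ 4) :=
    (integrableOn_wordFun adm_ω4 1).mono_set window₄_subset
  have i31 : IntegrableOn (wordFun ω31 4) (window lo₄ hi₄ 4) :=
    (integrableOn_wordFun adm_ω31 4).mono_set window₄_subset
  rw [← integral_sub i4 i31]
  exact setIntegral_pos_of_pos_on (isOpen_window _ _ _) window₄_nonempty (fun t ht => gap_pos ht)
    (i4.sub i31)

/-- The lower endpoints of the box are rational. [folklore] -/
def loQ (i : ℕ) : ℚ := ([1/2, 1/5, 3/20, 1/20] : List ℚ).getD i 0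
/-- The upper endpoints of the box are rational. [folklore] -/
def hiQ (i : ℕ) : ℚ := ([3/5, 1/4, 1/5, 1/10] : List ℚ).getD i 0

/-- `lo₄` is the cast of `loQ`. [folklore] -/
theorem lo₄_eq (i : ℕ) : lo₄ i = (loQ i : ℝ) := rfl
/-- `hi₄` is the cast of `hiQ`. [folklore] -/
theorem hi₄_eq (i : ℕ) : hi₄ i = (hiQ i : ℝ) := rfl

open MvPolynomial (aeval X C) in
/-- **The box is `ℚ`-semialgebraic** (finite intersection of `tᵢ − aᵢ > 0`, `bᵢ − tᵢ > 0`, rational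
`aᵢ, bᵢ`), so it is a legitimate DOMAIN of an integral representation. [folklore] -/
theorem isSemialgebraic_window₄ :
    Literature.ModelTheory.ExponentialFields.IsSemialgebraic ℚ (window lo₄ hi₄ 4) := by
  have h : window lo₄ hi₄ 4 = ⋂ i ∈ (Finset.univ : Finset (Fin 4)),
      ({t : Fin 4 → ℝ | 0 < aeval t (X i - C (loQ i) : MvPolynomial (Fin 4) ℚ)} ∩
        {t | 0 < aeval t (C (hiQ i) - X i : MvPolynomial (Fin 4) ℚ)}) := by
    ext t
    simp only [window, mem_Ioo, lo₄_eq, hi₄_eq, mem_setOf_eq, Finset.mem_univ, mem_iInter, true_implies,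
      mem_inter_iff, map_sub, MvPolynomial.aeval_X, MvPolynomial.aeval_C, eq_ratCast, sub_pos]
  rw [h]
  exact Literature.ModelTheory.ExponentialFields.IsSemialgebraic.biInter _ _ fun i _ =>
    (Literature.ModelTheory.ExponentialFields.isSemialgebraic_setOf_eval_pos _).inter
      (Literature.ModelTheory.ExponentialFields.isSemialgebraic_setOf_eval_pos _)

/-- The word representation RESTRICTED TO THE BOX: `[B, q·ω_ε]`. [folklore] -/
def boxRep (ε : Fin 4 → Bool) (q : ℚ) (hε : Adm ε) : IntegralRep 4 :=
  (wordRep ε q hε).restrict (window lo₄ hi₄ 4) isSemialgebraic_window₄ window₄_subset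

/-- Domain of the box representation. [folklore] -/
@[simp] theorem boxRep_domain (ε : Fin 4 → Bool) (q : ℚ) (hε : Adm ε) :
    (boxRep ε q hε).domain = window lo₄ hi₄ 4 := rfl

/-- Integrand of the box representation. [folklore] -/
@[simp] theorem boxRep_integrand (ε : Fin 4 → Bool) (q : ℚ) (hε : Adm ε) :
    (boxRep ε q hε).integrand = wordFun ε q := rfl

/-- **On the box the two values differ**: `value [B, ω₀₀₀₁] > value [B, 4ω₀₀₁₁]`. [folklore] -/
theorem value_boxRep_gap_pos : 0 < (boxRep ω4 1 adm_ω4).value - (boxRep ω31 4 adm_ω31).value :=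
  integral_gap_pos

/-- The crux WITHOUT the hypothesis `r.domain = Δ₄` (the common domain is then free). -/
def WithoutDomain : Prop :=
  ∀ (r r' : IntegralRep 4), EqOn r.integrand (fun t => 1 / (t 0 * t 1 * t 2 * (1 - t 3))) r.domain →
    r'.domain = r.domain → EqOn r'.integrand (fun t => 4 / (t 0 * t 1 * (1 - t 2) * (1 - t 3))) r'.domain →
    Equivalent r r'

/-- **`r.domain = Δ₄` is load-bearing**: on the box `B` as common domain the two representations have
different values, hence are not equivalent (soundness). The identity `ζ(4) = 4ζ(3,1)` is GLOBAL on the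
simplex — no chain can be assembled from moves that act identically on every sub-domain. [folklore] -/
theorem crux_false_without_domain : ¬ WithoutDomain := fun h => by
  have hE := h (boxRep ω4 1 adm_ω4) (boxRep ω31 4 adm_ω31) (fun t _ => wordFun_ω4_one t) rfl
    (fun t _ => wordFun_ω31_four t)
  have hv := Equivalent.value_eq_holds hE
  exact value_boxRep_gap_pos.ne' (sub_eq_zero.2 hv)

/-- The crux WITHOUT the hypothesis on `r.integrand`. -/
def WithoutIntegrand : Prop :=
  ∀ (r r' : IntegralRep 4), r.domain = {t | 1 > t 0 ∧ t 0 > t 1 ∧ t 1 > t 2 ∧ t 2 > t 3 ∧ t 3 > 0} →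
    r'.domain = r.domain → EqOn r'.integrand (fun t => 4 / (t 0 * t 1 * (1 - t 2) * (1 - t 3))) r'.domain →
    Equivalent r r'

/-- `4ζ(3,1) = π⁴/90 > 0`. [folklore] -/
theorem value_right_pos : 0 < (wordRep ω31 4 adm_ω31).value := by rw [value_right]; positivity

/-- **The hypothesis on `r.integrand` is load-bearing**: `r = [Δ₄, 0]` has value `0 ≠ 4ζ(3,1)`. [folklore] -/
theorem crux_false_without_integrand : ¬ WithoutIntegrand := fun h => by
  have hE := h (wordRep ω4 0 adm_ω4) (wordRep ω31 4 adm_ω31) (by rw [wordRep_domain, simplex4_eq]) rfl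
    (fun t _ => wordFun_ω31_four t)
  have hv := Equivalent.value_eq_holds hE
  rw [value_wordRep ω4 0] at hv
  simp only [Rat.cast_zero, zero_mul] at hv
  exact value_right_pos.ne hv

/-- The crux WITHOUT the hypothesis `r'.domain = r.domain`. -/
def WithoutDomain' : Prop :=
  ∀ (r r' : IntegralRep 4), r.domain = {t | 1 > t 0 ∧ t 0 > t 1 ∧ t 1 > t 2 ∧ t 2 > t 3 ∧ t 3 > 0} →
    EqOn r.integrand (fun t => 1 / (t 0 * t 1 * t 2 * (1 - t 3))) r.domain →
    EqOn r'.integrand (fun t => 4 / (t 0 * t 1 * (1 - t 2) * (1 - t 3))) r'.domain →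
    Equivalent r r'

/-- The empty representation `[∅, 0]` in dimension 4 (value `0`). [folklore] -/
def emptyRep : IntegralRep 4 where
  domain := ∅
  integrand := fun _ => 0
  isSemialgebraic_domain := Literature.ModelTheory.ExponentialFields.isSemialgebraic_empty
  isSemialgebraicFunOn_integrand := by
    simpa using isSemialgebraicFunOn_aeval
      (Literature.ModelTheory.ExponentialFields.isSemialgebraic_empty (k := ℚ) (ι := Fin 4) (R := ℝ))
      (0 : MvPolynomial (Fin 4) ℚ)
  integrableOn := integrableOn_empty

/-- `value [∅, 0] = 0`. [folklore] -/
@[simp] theorem value_emptyRep : emptyRep.value = 0 := by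
  simp [IntegralRep.value, emptyRep]

/-- **`r'.domain = r.domain` is load-bearing**: `r' = [∅, ·]` satisfies the integrand hypothesis
vacuously and has value `0 ≠ ζ(4)`. [folklore] -/
theorem crux_false_without_domain' : ¬ WithoutDomain' := fun h => by
  have hE := h (wordRep ω4 1 adm_ω4) emptyRep (by rw [wordRep_domain, simplex4_eq])
    (fun t _ => wordFun_ω4_one t) (fun t ht => absurd ht (Set.notMem_empty t))
  have hv := Equivalent.value_eq_holds hE
  rw [value_ω4, value_emptyRep] at hv
  have : (0 : ℝ) < Real.pi ^ 4 / 90 := by positivity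
  exact this.ne' hv

/-- The crux WITHOUT the hypothesis on `r'.integrand`. -/
def WithoutIntegrand' : Prop :=
  ∀ (r r' : IntegralRep 4), r.domain = {t | 1 > t 0 ∧ t 0 > t 1 ∧ t 1 > t 2 ∧ t 2 > t 3 ∧ t 3 > 0} →
    EqOn r.integrand (fun t => 1 / (t 0 * t 1 * t 2 * (1 - t 3))) r.domain → r'.domain = r.domain →
    Equivalent r r'

/-- **The hypothesis on `r'.integrand` is load-bearing**: `r' = [Δ₄, 0]` has value `0 ≠ ζ(4)`. [folklore] -/
theorem crux_false_without_integrand' : ¬ WithoutIntegrand' := fun h => by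
  have hE := h (wordRep ω4 1 adm_ω4) (wordRep ω31 0 adm_ω31) (by rw [wordRep_domain, simplex4_eq])
    (fun t _ => wordFun_ω4_one t) rfl
  have hv := Equivalent.value_eq_holds hE
  rw [value_ω4, value_wordRep ω31 0] at hv
  simp only [Rat.cast_zero, zero_mul] at hv
  have : (0 : ℝ) < Real.pi ^ 4 / 90 := by positivity
  exact this.ne' hv

/-- **The constant is pinned by soundness**: `[Δ₄, ω₀₀₀₁] − [Δ₄, q·ω₀₀₁₁] ∈ relations` forces `q = 4`
(`ζ(4) = π⁴/90`, `ζ(3,1) = π⁴/360`, `π ≠ 0`). [folklore] -/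
theorem coeff_eq_four_of_mem {q : ℚ}
    (h : of (wordRep ω4 1 adm_ω4) - of (wordRep ω31 q adm_ω31) ∈ relations) : q = 4 := by
  have hv := Equivalent.value_eq_holds (r := wordRep ω4 1 adm_ω4) (r' := wordRep ω31 q adm_ω31) h
  rw [value_ω4, value_wordRep ω31 q, value_ω31] at hv
  have hpi : Real.pi ^ 4 ≠ 0 := by positivity
  have h' : ((q : ℝ) - 4) * Real.pi ^ 4 = 0 := by linear_combination (360 : ℝ) * hv.symm
  rcases mul_eq_zero.1 h' with h0 | h0
  · exact_mod_cast (sub_eq_zero.1 h0)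
  · exact absurd h0 hpi

/-- The evaluative test passes EXACTLY at `q = 4`. [folklore] -/
theorem eval_withCoeff_eq_zero_iff (q : ℚ) :
    eval (of (wordRep ω4 1 adm_ω4) - of (wordRep ω31 q adm_ω31)) = 0 ↔ q = 4 := by
  rw [map_sub, eval_of, eval_of, value_ω4, value_wordRep ω31 q, value_ω31, sub_eq_zero]
  constructor
  · intro hv
    have hpi : Real.pi ^ 4 ≠ 0 := by positivity
    have h' : ((q : ℝ) - 4) * Real.pi ^ 4 = 0 := by linear_combination (360 : ℝ) * hv.symm
    rcases mul_eq_zero.1 h' with h0 | h0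
    · exact_mod_cast (sub_eq_zero.1 h0)
    · exact absurd h0 hpi
  · rintro rfl
    push_cast; ring

/-- **`4` is load-bearing**: with any other rational constant the statement is FALSE (soundness). [folklore] -/
theorem crux_false_withCoeff {q : ℚ} (hq : q ≠ 4) : ¬ WithCoeff q := fun h =>
  hq (coeff_eq_four_of_mem ((withCoeff_iff q).1 h))

/-- In particular the naive reading "`ζ(4) = ζ(3,1)` in the calculus" is false. [folklore] -/
theorem not_withCoeff_one : ¬ WithCoeff 1 := crux_false_withCoeff (by norm_num)

/-- … and so is the stuffle-free misreading "`ζ(4) = 2ζ(3,1)`" (coefficient of the shuffle alone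
halved). [folklore] -/
theorem not_withCoeff_two : ¬ WithCoeff 2 := crux_false_withCoeff (by norm_num)

end Summit.KontsevichZagierPeriods.GpcZeta4Eq4zeta31.Negative
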